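import Summits.Ventures.PercRepro.C026UnicyclicCount

/-!
# THEOREM U: C-026 at every edge weight on every marked multigraph with at most one cycle (p6, gen 12)

`proofs/P6-unicyclic.md`.  Induction on the number of edges over all finite marked multigraphs:

* a dead edge (weight `0`) is deleted — the live minor has fewer edges and still at most one cycle
  (`C026At_of_dead_of_ih`, by `law3_eq_liveMinor` and `AtMostOneCycle.minor_bot`);
* otherwise a loop is killed (R2), a parallel pair merged (R3), an edge at a pendant non-mark killed
  (R5), a series pair at a non-mark contracted (R4, `AtMostOneCycle.seriesGraph`), or the pendant
  mark `c` moved to its neighbour (R6) — each step leaves a dead edge, so the first case applies;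
* if no step applies, the terminal count `card_supp_le_five` leaves at most five live vertices and
  p6's landed `C026At_of_card_liveSupp_le_five` (C026SmallReduction.lean, on p5's `c026UpTo5`) closes;
  coinciding marks `c = a` or `c = b` are trivial (`C026At_of_eq_ac`, `C026At_of_eq_bc`).

**`C026At_of_atMostOneCycle`**: `G.AtMostOneCycle → IsProb p → G.C026At p a b c`.
-/

namespace PercRepro

open Finset

namespace MultiGraph

section Coincide

variable {V E : Type} [Fintype E] [DecidableEq E] {G : MultiGraph V E}

/-- C-026 is trivial when `c = a`: the rows `ab|c` and `a|b|c` vanish. -/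
theorem C026At_of_eq_ac {p : E → ℝ} (hp : IsProb p) (a b : V) : G.C026At p a b a := by
  unfold C026At
  have h1 : G.law3 p a b a 1 = 0 := by
    rw [law3_one, partitionEvent_row_ab_c]
    have : G.connEvent a b ∩ G.sepEvent a a = ∅ := by
      ext ω
      simp only [Set.mem_inter_iff, mem_connEvent, mem_sepEvent, Set.mem_empty_iff_false,
        iff_false, not_and, not_not]
      intro _
      exact Conn.refl G ω a
    rw [this, prob_empty]
  have h4 : G.law3 p a b a 4 = 0 := by
    rw [law3_four, partitionEvent_row_a_b_c]
    have : G.sepEvent a b ∩ G.sepEvent a a ∩ G.sepEvent b a = ∅ := by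
      ext ω
      simp only [Set.mem_inter_iff, mem_sepEvent, Set.mem_empty_iff_false, iff_false, not_and]
      rintro ⟨_, haa⟩ _
      exact haa (Conn.refl G ω a)
    rw [this, prob_empty]
  have h2 : 0 ≤ G.law3 p a b a 2 := prob_nonneg hp _
  have h3 : 0 ≤ G.law3 p a b a 3 := prob_nonneg hp _
  rw [h1, h4]
  linarith

/-- C-026 is trivial when `c = b`: the rows `ab|c` and `a|b|c` vanish. -/
theorem C026At_of_eq_bc {p : E → ℝ} (hp : IsProb p) (a b : V) : G.C026At p a b b := by
  unfold C026At
  have h1 : G.law3 p a b b 1 = 0 := by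
    rw [law3_one, partitionEvent_row_ab_c]
    have : G.connEvent a b ∩ G.sepEvent a b = ∅ := by
      ext ω
      simp only [Set.mem_inter_iff, mem_connEvent, mem_sepEvent, Set.mem_empty_iff_false,
        iff_false, not_and, not_not]
      exact id
    rw [this, prob_empty]
  have h4 : G.law3 p a b b 4 = 0 := by
    rw [law3_four, partitionEvent_row_a_b_c]
    have : G.sepEvent a b ∩ G.sepEvent a b ∩ G.sepEvent b b = ∅ := by
      ext ω
      simp only [Set.mem_inter_iff, mem_sepEvent, Set.mem_empty_iff_false, iff_false, not_and]
      intro _ h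
      exact h (Conn.refl G ω b)
    rw [this, prob_empty]
  have h2 : 0 ≤ G.law3 p a b b 2 := prob_nonneg hp _
  have h3 : 0 ≤ G.law3 p a b b 3 := prob_nonneg hp _
  rw [h1, h4]
  linarith

end Coincide

section Steps

variable {V E : Type} [Fintype V] [Fintype E] [DecidableEq V] [DecidableEq E] {G : MultiGraph V E}

omit [Fintype V] [DecidableEq E] in
/-- A vertex of degree one is pendant on its single edge. -/
theorem exists_pendantOn_of_edgeDeg_one (hl : ∀ e, G.fst e ≠ G.snd e) {v : V}
    (hv : G.edgeDeg v = 1) : ∃ w f, G.PendantOn v w f ∧ v ≠ w := by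
  obtain ⟨f, hf⟩ := Finset.card_eq_one.mp hv
  have hmem : ∀ e, (G.fst e = v ∨ G.snd e = v) ↔ e = f := by
    intro e
    constructor
    · intro he
      have : e ∈ (univ.filter fun e => G.fst e = v ∨ G.snd e = v) := by simp [he]
      rw [hf] at this
      simpa using this
    · intro he
      rw [he]
      have : f ∈ ({f} : Finset E) := Finset.mem_singleton_self f
      rw [← hf] at this
      simpa using this
  have hfv : G.fst f = v ∨ G.snd f = v := (hmem f).mpr rfl
  rcases hfv with h | h
  · refine ⟨G.snd f, f, ⟨⟨fun e he => ?_, ⟨f, Or.inl h⟩⟩, fun e he => (hmem e).mp he⟩, ?_⟩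
    · rw [(hmem e).mp he]
      exact Or.inl ⟨h, rfl⟩
    · intro hh
      exact hl f (h.trans hh)
  · refine ⟨G.fst f, f, ⟨⟨fun e he => ?_, ⟨f, Or.inr h⟩⟩, fun e he => (hmem e).mp he⟩, ?_⟩
    · rw [(hmem e).mp he]
      exact Or.inr ⟨rfl, h⟩
    · intro hh
      exact hl f (hh.symm.trans h.symm)

omit [Fintype V] in
/-- A vertex of degree two is the middle of a series pair. -/
theorem exists_isSeries_of_edgeDeg_two (hl : ∀ e, G.fst e ≠ G.snd e) {v : V}
    (hv : G.edgeDeg v = 2) : ∃ e₁ e₂ y z, G.IsSeries e₁ e₂ v y z := by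
  obtain ⟨e₁, e₂, hne, hf⟩ := Finset.card_eq_two.mp hv
  have hmem : ∀ e, (G.fst e = v ∨ G.snd e = v) ↔ (e = e₁ ∨ e = e₂) := by
    intro e
    constructor
    · intro he
      have : e ∈ (univ.filter fun e => G.fst e = v ∨ G.snd e = v) := by simp [he]
      rw [hf] at this
      simpa using this
    · intro he
      have : e ∈ ({e₁, e₂} : Finset E) := by simpa using he
      rw [← hf] at this
      simpa using this
  have h1 : G.fst e₁ = v ∨ G.snd e₁ = v := (hmem e₁).mpr (Or.inl rfl)
  have h2 : G.fst e₂ = v ∨ G.snd e₂ = v := (hmem e₂).mpr (Or.inr rfl)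
  refine ⟨e₁, e₂, if G.fst e₁ = v then G.snd e₁ else G.fst e₁,
    if G.fst e₂ = v then G.snd e₂ else G.fst e₂, ⟨hne, ?_, ?_, ?_, ?_, fun e he => (hmem e).mp he⟩⟩
  · by_cases h : G.fst e₁ = v
    · rw [if_pos h]
      exact Or.inr ⟨h, rfl⟩
    · rw [if_neg h]
      rcases h1 with h1 | h1
      · exact absurd h1 h
      · exact Or.inl ⟨rfl, h1⟩
  · by_cases h : G.fst e₂ = v
    · rw [if_pos h]
      exact Or.inl ⟨h, rfl⟩
    · rw [if_neg h]
      rcases h2 with h2 | h2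
      · exact absurd h2 h
      · exact Or.inr ⟨rfl, h2⟩
  · by_cases h : G.fst e₁ = v
    · rw [if_pos h]
      intro hh
      exact hl e₁ (h.trans hh.symm)
    · rw [if_neg h]
      exact h
  · by_cases h : G.fst e₂ = v
    · rw [if_pos h]
      intro hh
      exact hl e₂ (h.trans hh.symm)
    · rw [if_neg h]
      exact h

end Steps

section Main

/-- The induction hypothesis: C-026 on every marked multigraph with at most one cycle and fewer
edges. -/
def IH (E : Type) [Fintype E] : Prop :=
  ∀ (V' E' : Type) [Fintype V'] [Fintype E'] [DecidableEq V'] [DecidableEq E'],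
    Fintype.card E' < Fintype.card E → ∀ (G' : MultiGraph V' E'), G'.AtMostOneCycle →
      ∀ (p' : E' → ℝ), IsProb p' → ∀ a' b' c' : V', G'.C026At p' a' b' c'

variable {V E : Type} [Fintype V] [Fintype E] [DecidableEq V] [DecidableEq E]

omit [DecidableEq V] in
/-- **A dead edge**: the live minor has fewer edges and at most one cycle; the induction hypothesis
closes through `law3_eq_liveMinor`. -/
theorem C026At_of_dead_of_ih (ih : IH E) (G : MultiGraph V E) (hG : G.AtMostOneCycle)
    {p : E → ℝ} (hp : IsProb p) {e : E} (he : p e = 0) (a b c : V) : G.C026At p a b c := by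
  classical
  unfold C026At
  rw [G.law3_eq_liveMinor p a b c]
  have hcard : Fintype.card (Face (liveConfig p) ⊥) < Fintype.card E := by
    refine Fintype.card_subtype_lt (x := e) ?_
    simp [liveConfig, he]
  exact ih _ _ hcard (G.minor (liveConfig p) ⊥) (hG.minor_bot _) _ (isProb_faceWeight hp _ _) _ _ _

/-- **The induction step**: every instance with at most one cycle and `n` edges, given the
hypothesis below `n`. -/
theorem C026At_of_atMostOneCycle_step (ih : IH E) (G : MultiGraph V E) (hG : G.AtMostOneCycle)
    (p : E → ℝ) (hp : IsProb p) (a b c : V) : G.C026At p a b c := by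
  classical
  -- (A) a dead edge
  by_cases hdead : ∃ e, p e = 0
  · obtain ⟨e, he⟩ := hdead
    exact C026At_of_dead_of_ih ih G hG hp he a b c
  have hlive : ∀ e, p e ≠ 0 := fun e he => hdead ⟨e, he⟩
  -- (R2) a loop
  by_cases hloop : ∃ e, G.fst e = G.snd e
  · obtain ⟨e, he⟩ := hloop
    exact C026At_of_loop he
      (C026At_of_dead_of_ih ih G hG (hp.update e ⟨le_rfl, zero_le_one⟩) (Function.update_self _ _ _) a b c)
  have hloop' : ∀ e, G.fst e ≠ G.snd e := fun e he => hloop ⟨e, he⟩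
  -- (R3) a parallel pair
  by_cases hpar : ∃ e₁ e₂, e₁ ≠ e₂ ∧ G.Parallel e₁ e₂
  · obtain ⟨e₁, e₂, hne, hp12⟩ := hpar
    refine C026At_of_step (SPStep3.parallel (a := a) (b := b) (c := c) (p := p) hne hp12) ?_
    have hdead' : parWeight p e₁ e₂ e₂ = 0 := by
      unfold parWeight
      rw [Function.update_of_ne hne.symm, Function.update_self]
    exact C026At_of_dead_of_ih ih G hG (isProb_parWeight hp e₁ e₂) hdead' a b c
  -- (R5) a pendant non-mark
  by_cases hpend : ∃ v w f, (v ≠ a ∧ v ≠ b ∧ v ≠ c) ∧ G.Pendant v w ∧ v ≠ w ∧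
      f ∈ G.edgesAt ({v} : Set V)
  · obtain ⟨v, w, f, hv, hpv, hvw, hf⟩ := hpend
    refine C026At_of_step (SPStep3.pendant (a := a) (b := b) (c := c) (p := p) hpv hvw hv hf) ?_
    exact C026At_of_dead_of_ih ih G hG (hp.update f ⟨le_rfl, zero_le_one⟩) (Function.update_self _ _ _) a b c
  have hpend' : ∀ v w f, (v ≠ a ∧ v ≠ b ∧ v ≠ c) → G.Pendant v w → v ≠ w →
      f ∉ G.edgesAt ({v} : Set V) := fun v w f hv hpv hvw hf => hpend ⟨v, w, f, hv, hpv, hvw, hf⟩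
  -- (R4) a series pair at a non-mark
  by_cases hser : ∃ e₁ e₂ x y z, G.IsSeries e₁ e₂ x y z ∧ (x ≠ a ∧ x ≠ b ∧ x ≠ c)
  · obtain ⟨e₁, e₂, x, y, z, hs, hx⟩ := hser
    refine C026At_of_step (SPStep3.series (a := a) (b := b) (c := c) (p := p) hs hx) ?_
    have hdead' : serWeight p e₁ e₂ e₂ = 0 := by
      unfold serWeight
      rw [Function.update_of_ne hs.ne.symm, Function.update_self]
    exact C026At_of_dead_of_ih ih _ (hG.seriesGraph hs) (isProb_serWeight hp e₁ e₂) hdead' a b c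
  have hser' : ∀ e₁ e₂ x y z, G.IsSeries e₁ e₂ x y z → ¬ (x ≠ a ∧ x ≠ b ∧ x ≠ c) :=
    fun e₁ e₂ x y z hs hx => hser ⟨e₁, e₂, x, y, z, hs, hx⟩
  -- coinciding marks
  by_cases hca : c = a
  · subst hca
    exact C026At_of_eq_ac hp _ _
  by_cases hcb : c = b
  · subst hcb
    exact C026At_of_eq_bc hp _ _
  -- (R6) the pendant mark
  by_cases hpm : ∃ w f, G.PendantOn c w f ∧ c ≠ w
  · obtain ⟨w, f, h, hcw⟩ := hpm
    refine C026At_of_pendantMark hp h hcw hca hcb ?_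
    exact C026At_of_dead_of_ih ih G hG (hp.update f ⟨le_rfl, zero_le_one⟩) (Function.update_self _ _ _) a b w
  have hpm' : ∀ w f, G.PendantOn c w f → c ≠ w → False := fun w f h hcw => hpm ⟨w, f, h, hcw⟩
  -- terminal: at most five live vertices
  have hnm : ∀ v, v ≠ a → v ≠ b → v ≠ c → G.edgeDeg v = 0 ∨ 3 ≤ G.edgeDeg v := by
    intro v hva hvb hvc
    by_cases h0 : G.edgeDeg v = 0
    · exact Or.inl h0
    by_cases h1 : G.edgeDeg v = 1
    · obtain ⟨w, f, hpo, hvw⟩ := exists_pendantOn_of_edgeDeg_one hloop' h1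
      exact absurd hpo.mem (hpend' v w f ⟨hva, hvb, hvc⟩ hpo.1 hvw)
    by_cases h2 : G.edgeDeg v = 2
    · obtain ⟨e₁, e₂, y, z, hs⟩ := exists_isSeries_of_edgeDeg_two hloop' h2
      exact absurd ⟨hva, hvb, hvc⟩ (hser' e₁ e₂ v y z hs)
    right
    omega
  have hcdeg : G.edgeDeg c ≠ 1 := by
    intro h1
    obtain ⟨w, f, hpo, hcw⟩ := exists_pendantOn_of_edgeDeg_one hloop' h1
    exact hpm' w f hpo hcw
  have hcount := card_supp_le_five (G := G) hloop' a b c hnm hcdeg hG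
  refine G.C026At_of_card_liveSupp_le_five hp a b c ?_
  calc Fintype.card {v // G.LiveSupp p a b c v}
      ≤ Fintype.card ((univ.filter fun v => v = a ∨ v = b ∨ v = c ∨
          ∃ e, G.fst e = v ∨ G.snd e = v) : Finset V) := by
        refine Fintype.card_le_of_injective (fun x => ⟨x.1, ?_⟩) fun x y hxy => ?_
        · have hx := x.2
          simp only [LiveSupp] at hx
          simp only [Finset.mem_filter, Finset.mem_univ, true_and]
          rcases hx with h | h | h | ⟨e, _, he⟩
          · exact Or.inl h
          · exact Or.inr (Or.inl h)
          · exact Or.inr (Or.inr (Or.inl h))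
          · exact Or.inr (Or.inr (Or.inr ⟨e, he⟩))
        · exact Subtype.ext (Subtype.mk.inj hxy)
    _ = (univ.filter fun v => v = a ∨ v = b ∨ v = c ∨ ∃ e, G.fst e = v ∨ G.snd e = v).card :=
        Fintype.card_coe _
    _ ≤ 5 := hcount

/-- **THEOREM U**: C-026 at every edge weight on every marked multigraph with at most one cycle. -/
theorem C026At_of_atMostOneCycle (G : MultiGraph V E) (hG : G.AtMostOneCycle) {p : E → ℝ}
    (hp : IsProb p) (a b c : V) : G.C026At p a b c := by
  suffices key : ∀ (n : ℕ) (V E : Type) [Fintype V] [Fintype E] [DecidableEq V] [DecidableEq E],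
      Fintype.card E = n → ∀ (G : MultiGraph V E), G.AtMostOneCycle → ∀ (p : E → ℝ), IsProb p →
        ∀ a b c : V, G.C026At p a b c from key _ V E rfl G hG p hp a b c
  intro n
  induction n using Nat.strong_induction_on with
  | _ n ih =>
    intro V E _ _ _ _ hn G hG p hp a b c
    refine C026At_of_atMostOneCycle_step ?_ G hG p hp a b c
    intro V' E' _ _ _ _ hlt G' hG' p' hp' a' b' c'
    exact ih _ (hn ▸ hlt) V' E' rfl G' hG' p' hp' a' b' c'

end Main

end MultiGraph

end PercRepro
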